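import Mathlib
import HarnessLib
import Summits.HubbardSuperconductivity.HubbardSuperconductivity.Theorems.KLProgrammeKLRegimeCountertermMuFlow

/-!
# Route `KLProgramme` — child 3 of the K3 resplit `KLRegimeCountertermV7 := CountertermP2 klPredsV7 klWindowC`
# (stmt-HubbardSuperconductivity-19664): the CONSTANT PIECE of the normal-form extension, part B — the G-extension and the G two-leg
# objects split into δμ-flow and mean-free parts (seat hubbard-kl-k3c3-p1, technique «δμ-flow with `klAngularMean` constant piece»)

Continuation of `KLProgrammeKLRegimeCountertermMuFlow` (part A: `klAngularMean` API, `symInterp` value formula / linearity / constants):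

* §1 the G-extension: `(klFrameExtG L μ f)(p) = mean f + (symInterp L (χ_flat·(f∘θ − mean f)))(p)` (`eval_klFrameExtG`) — the
  δμ / mean-free split as an identity —, `klFrameExtG` of a constant angular function IS that constant (`eval_klFrameExtG_const`, all
  derivatives of order `≥ 1` vanish), additivity / homogeneity in `f`, and the `fsub` form the stage map `X ⊖ D_n^G(K′ ⊕ X)` of child 3
  uses (`eval_fsub_klFrameExtG`: the difference of two normal-form frames is the normal form of the difference of the profiles);
* §2 the G two-leg objects read through §1: `D_n^G(K)(p)`, `P^G(K)(p)` and the pieces `ℓ_n^G(K)(p)` split into their δμ-flow increment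
  `m_n(K) − m_{n-1}(K)` (`m_n = klAngularMean (ν_n(K))`) plus the mean-free interpolant increment (`eval_klTwoLegPieceG_succ_split`,
  `eval_klTwoLegPieceG_zero_split`), the telescoped δμ flow `Σ_{n ≤ N} (m_n − m_{n-1}) = m_N − m(K on its curve)`
  (`sum_klAngularMean_increments`: the counterterm's constant piece solves exactly the scalar equation `m_N(K) = 0`), and
  `RenormalisedAtF` from / to the split (`renormalisedAtF_of_split`, `abs_klAngularMean_localPart_le_of_renormalisedAtF`).

Proofs only (no definitions, no new facts); nothing is asserted about the Hubbard model.  References as in part A.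
-/

noncomputable section

namespace Summit.HubbardSuperconductivity.HubbardSuperconductivity.Theorems.KLRegimeSplit

set_option linter.dupNamespace false -- summit = problem name (single-conjunct summit), D-0017

open Real Finset MeasureTheory
open Literature.MathematicalPhysics.QuantumLattice Literature.Probability.LatticeModels
open Summit.HubbardSuperconductivity.HubbardSuperconductivity.Theorems.KLProgrammeLegKernels
open Summit.HubbardSuperconductivity.HubbardSuperconductivity.Theorems.DispersionFlow

/-! ## §1 The G-extension: δμ piece ⊕ mean-free piece -/

section Ext

variable (L : ℕ) [NeZero L]

/-- **The δμ / mean-free split of the G-extension, as an identity**: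
`(klFrameExtG L μ f)(p) = mean f + (symInterp L (χ_flat·(f∘θ − mean f)))(p)`. -/
theorem eval_klFrameExtG (μ : ℝ) (f : ℝ → ℝ) (p : Fin 2 → ℝ) :
    (klFrameExtG L μ f).eval p = klAngularMean f +
      (symInterp L (fun k => klFlatCutoff L μ k * (f (momentumAngle L k) - klAngularMean f))).eval p := by
  unfold klFrameExtG
  have h := eval_symInterp_add L (fun _ => klAngularMean f)
    (fun k => klFlatCutoff L μ k * (f (momentumAngle L k) - klAngularMean f)) p
  rw [eval_symInterp_const] at h
  exact h

/-- **The G-extension of a constant angular function is that constant frame**: `(klFrameExtG L μ (fun _ => c))(p) = c`. -/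
theorem eval_klFrameExtG_const (μ c : ℝ) (p : Fin 2 → ℝ) : (klFrameExtG L μ (fun _ => c)).eval p = c := by
  rw [eval_klFrameExtG, klAngularMean_const]
  simp only [sub_self, mul_zero]
  rw [eval_symInterp_zero, add_zero]

/-- The G-extension of a constant on `Momentum`. -/
theorem evalM_klFrameExtG_const (μ c : ℝ) : evalM (klFrameExtG L μ (fun _ => c)) = fun _ => c :=
  funext fun q => eval_klFrameExtG_const L μ c (WithLp.ofLp q)

/-- All derivatives of order `≥ 1` of the G-extension of a constant vanish. -/
theorem iteratedFDeriv_evalM_klFrameExtG_const (μ c : ℝ) {j : ℕ} (hj : j ≠ 0) (q : Momentum) :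
    iteratedFDeriv ℝ j (evalM (klFrameExtG L μ (fun _ => c))) q = 0 := by
  rw [evalM_klFrameExtG_const, iteratedFDeriv_const_of_ne hj]
  rfl

/-- **Additivity of the G-extension** at the level of values (interval-integrable profiles, so that the means add). -/
theorem eval_klFrameExtG_add (μ : ℝ) {f g : ℝ → ℝ} (hf : IntervalIntegrable f volume 0 (2 * π))
    (hg : IntervalIntegrable g volume 0 (2 * π)) (p : Fin 2 → ℝ) :
    (klFrameExtG L μ (fun θ => f θ + g θ)).eval p = (klFrameExtG L μ f).eval p + (klFrameExtG L μ g).eval p := by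
  rw [eval_klFrameExtG, eval_klFrameExtG, eval_klFrameExtG, klAngularMean_add hf hg]
  have : (fun k => klFlatCutoff L μ k * (f (momentumAngle L k) + g (momentumAngle L k) -
      (klAngularMean f + klAngularMean g))) = fun k => klFlatCutoff L μ k * (f (momentumAngle L k) - klAngularMean f) +
        klFlatCutoff L μ k * (g (momentumAngle L k) - klAngularMean g) := by
    funext k; ring
  rw [this, eval_symInterp_add]
  ring

/-- **Homogeneity of the G-extension** at the level of values (no integrability needed). -/
theorem eval_klFrameExtG_const_mul (μ a : ℝ) (f : ℝ → ℝ) (p : Fin 2 → ℝ) :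
    (klFrameExtG L μ (fun θ => a * f θ)).eval p = a * (klFrameExtG L μ f).eval p := by
  rw [eval_klFrameExtG, eval_klFrameExtG, klAngularMean_const_mul]
  have : (fun k => klFlatCutoff L μ k * (a * f (momentumAngle L k) - a * klAngularMean f)) =
      fun k => a * (klFlatCutoff L μ k * (f (momentumAngle L k) - klAngularMean f)) := by
    funext k; ring
  rw [this, eval_symInterp_const_mul]
  ring

/-- The G-extension of `-f` at the level of values. -/
theorem eval_klFrameExtG_neg (μ : ℝ) (f : ℝ → ℝ) (p : Fin 2 → ℝ) :
    (klFrameExtG L μ (fun θ => -f θ)).eval p = -(klFrameExtG L μ f).eval p := by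
  have h := eval_klFrameExtG_const_mul L μ (-1) f p
  simp only [neg_mul, one_mul] at h
  exact h

/-- **The G-extension of a difference** at the level of values (interval-integrable profiles). -/
theorem eval_klFrameExtG_sub (μ : ℝ) {f g : ℝ → ℝ} (hf : IntervalIntegrable f volume 0 (2 * π))
    (hg : IntervalIntegrable g volume 0 (2 * π)) (p : Fin 2 → ℝ) :
    (klFrameExtG L μ (fun θ => f θ - g θ)).eval p = (klFrameExtG L μ f).eval p - (klFrameExtG L μ g).eval p := by
  rw [eval_klFrameExtG, eval_klFrameExtG, eval_klFrameExtG, klAngularMean_sub hf hg]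
  have : (fun k => klFlatCutoff L μ k * (f (momentumAngle L k) - g (momentumAngle L k) -
      (klAngularMean f - klAngularMean g))) = fun k => klFlatCutoff L μ k * (f (momentumAngle L k) - klAngularMean f) -
        klFlatCutoff L μ k * (g (momentumAngle L k) - klAngularMean g) := by
    funext k; ring
  rw [this, eval_symInterp_sub]
  ring

/-- Adding a constant to the profile adds the constant frame (interval-integrable profile). -/
theorem eval_klFrameExtG_add_const (μ : ℝ) {f : ℝ → ℝ} (hf : IntervalIntegrable f volume 0 (2 * π)) (c : ℝ)
    (p : Fin 2 → ℝ) : (klFrameExtG L μ (fun θ => f θ + c)).eval p = (klFrameExtG L μ f).eval p + c := by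
  rw [eval_klFrameExtG_add L μ hf intervalIntegrable_const, eval_klFrameExtG_const]

/-- **The stage map's algebra**: `klFrameExtG f ⊖ klFrameExtG g = klFrameExtG (f − g)` at the level of values — the difference of two
normal-form frames is the normal form of the difference of their profiles (interval-integrable profiles). -/
theorem eval_fsub_klFrameExtG (μ : ℝ) {f g : ℝ → ℝ} (hf : IntervalIntegrable f volume 0 (2 * π))
    (hg : IntervalIntegrable g volume 0 (2 * π)) (p : Fin 2 → ℝ) :
    (fsub (klFrameExtG L μ f) (klFrameExtG L μ g)).eval p = (klFrameExtG L μ (fun θ => f θ - g θ)).eval p := by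
  rw [eval_fsub, eval_klFrameExtG_sub L μ hf hg]

end Ext

/-! ## §2 The G two-leg objects: δμ-flow increments plus mean-free increments -/

section TwoLegG

variable (L M : ℕ) [NeZero L] [NeZero M]

/-- **`D_n^G(K)(p)` split**: the scale-`n` G-extended local part is its δμ value `m_n(K) = mean ν_n(K)` plus the cut-off mean-free
interpolant. -/
theorem eval_klTwoLegPolyG_split (β U μ : ℝ) (K : TrigPolyC4v) (n : ℕ) (p : Fin 2 → ℝ) :
    (klTwoLegPolyG L M β U μ K n).eval p = klAngularMean (klLocalPart L M β U μ K n) +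
      (symInterp L (fun k => klFlatCutoff L μ k *
        (klLocalPart L M β U μ K n (momentumAngle L k) - klAngularMean (klLocalPart L M β U μ K n)))).eval p :=
  eval_klFrameExtG L μ _ p

/-- **`P^G(K)(p)` split**: the normal form of the frame is the mean of `K` on its own Fermi curve plus the cut-off mean-free interpolant. -/
theorem eval_klFrameProjG_split (μ : ℝ) (K : TrigPolyC4v) (p : Fin 2 → ℝ) :
    (klFrameProjG L μ K).eval p = klAngularMean (fun θ => K.eval (klFermiPoint μ K θ)) +
      (symInterp L (fun k => klFlatCutoff L μ k * (K.eval (klFermiPoint μ K (momentumAngle L k)) -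
        klAngularMean (fun θ => K.eval (klFermiPoint μ K θ))))).eval p :=
  eval_klFrameExtG L μ _ p

/-- **The G-piece at scale `n + 1` split**: δμ-flow increment `m_{n+1}(K) − m_n(K)` plus the mean-free interpolant increment
(an identity; no integrability needed). -/
theorem eval_klTwoLegPieceG_succ_split (β U μ : ℝ) (K : TrigPolyC4v) (n : ℕ) (p : Fin 2 → ℝ) :
    (klTwoLegPieceG L M β U μ K (n + 1)).eval p =
      (klAngularMean (klLocalPart L M β U μ K (n + 1)) - klAngularMean (klLocalPart L M β U μ K n)) +
      ((symInterp L (fun k => klFlatCutoff L μ k *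
          (klLocalPart L M β U μ K (n + 1) (momentumAngle L k) - klAngularMean (klLocalPart L M β U μ K (n + 1))))).eval p -
        (symInterp L (fun k => klFlatCutoff L μ k *
          (klLocalPart L M β U μ K n (momentumAngle L k) - klAngularMean (klLocalPart L M β U μ K n)))).eval p) := by
  rw [klTwoLegPieceG_succ, eval_fsub, eval_klTwoLegPolyG_split, eval_klTwoLegPolyG_split]
  ring

/-- **The G-piece at scale `0` split**: δμ-flow increment `m_0(K) − mean (K on its curve)` plus the mean-free interpolant increment. -/
theorem eval_klTwoLegPieceG_zero_split (β U μ : ℝ) (K : TrigPolyC4v) (p : Fin 2 → ℝ) :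
    (klTwoLegPieceG L M β U μ K 0).eval p =
      (klAngularMean (klLocalPart L M β U μ K 0) - klAngularMean (fun θ => K.eval (klFermiPoint μ K θ))) +
      ((symInterp L (fun k => klFlatCutoff L μ k *
          (klLocalPart L M β U μ K 0 (momentumAngle L k) - klAngularMean (klLocalPart L M β U μ K 0)))).eval p -
        (symInterp L (fun k => klFlatCutoff L μ k * (K.eval (klFermiPoint μ K (momentumAngle L k)) -
          klAngularMean (fun θ => K.eval (klFermiPoint μ K θ))))).eval p) := by
  rw [klTwoLegPieceG_zero, eval_fsub, eval_klTwoLegPolyG_split, eval_klFrameProjG_split]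
  ring

/-- **The telescoped δμ flow**: the δμ-flow increments of the scales `n ≤ N` sum to `m_N(K) − mean (K on its curve)` — the constant
part of `D_N^G(K) ⊖ P^G(K) = Σ_{n ≤ N} ℓ_n^G(K)`; the counterterm's constant piece solves exactly the scalar equation `m_N(K) = 0`. -/
theorem sum_klAngularMean_increments (β U μ : ℝ) (K : TrigPolyC4v) (N : ℕ) :
    (klAngularMean (klLocalPart L M β U μ K 0) - klAngularMean (fun θ => K.eval (klFermiPoint μ K θ))) +
      ∑ n ∈ range N, (klAngularMean (klLocalPart L M β U μ K (n + 1)) - klAngularMean (klLocalPart L M β U μ K n)) =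
      klAngularMean (klLocalPart L M β U μ K N) - klAngularMean (fun θ => K.eval (klFermiPoint μ K θ)) := by
  induction N with
  | zero => simp
  | succ N ih => rw [sum_range_succ, ← add_assoc, ih]; ring

/-- **Sup bound of a δμ-flow increment by the profiles**: if the local parts at two scales differ by at most `B` at every angle, their
δμ values differ by at most `B` (interval-integrable local parts). -/
theorem abs_klAngularMean_localPart_sub_le {β U μ : ℝ} {K : TrigPolyC4v} {n n' : ℕ} {B : ℝ}
    (hn : IntervalIntegrable (klLocalPart L M β U μ K n) volume 0 (2 * π))
    (hn' : IntervalIntegrable (klLocalPart L M β U μ K n') volume 0 (2 * π))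
    (h : ∀ θ, |klLocalPart L M β U μ K n θ - klLocalPart L M β U μ K n' θ| ≤ B) :
    |klAngularMean (klLocalPart L M β U μ K n) - klAngularMean (klLocalPart L M β U μ K n')| ≤ B :=
  abs_klAngularMean_sub_le hn hn' fun θ _ => h θ

/-- **Renormalisation from the split**: if the δμ value and the mean-free part of the scale-`n` local part are each within half a
tolerance, the local part is within the tolerance (`RenormalisedAtF` is the case `t = cr·|U|·Λ_n²/e₀`). -/
theorem abs_localPart_le_of_split {β U μ : ℝ} {K : TrigPolyC4v} {n : ℕ} {t : ℝ}
    (hmean : |klAngularMean (klLocalPart L M β U μ K n)| ≤ t / 2)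
    (hmf : ∀ θ, |klLocalPart L M β U μ K n θ - klAngularMean (klLocalPart L M β U μ K n)| ≤ t / 2) (θ : ℝ) :
    |klLocalPart L M β U μ K n θ| ≤ t := by
  have h := abs_add_le (klAngularMean (klLocalPart L M β U μ K n))
    (klLocalPart L M β U μ K n θ - klAngularMean (klLocalPart L M β U μ K n))
  rw [add_sub_cancel] at h
  linarith [hmf θ]

/-- `RenormalisedAtF` from the split (δμ value and mean-free part each within half the quadratic tolerance). -/
theorem renormalisedAtF_of_split {β U μ : ℝ} {K : TrigPolyC4v} {R : RenConsts} {n : ℕ}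
    (hmean : |klAngularMean (klLocalPart L M β U μ K n)| ≤ R.cr * |U| * klScale klE0 n ^ 2 / klE0 / 2)
    (hmf : ∀ θ, |klLocalPart L M β U μ K n θ - klAngularMean (klLocalPart L M β U μ K n)| ≤
      R.cr * |U| * klScale klE0 n ^ 2 / klE0 / 2) :
    RenormalisedAtF L M β U μ K R n := fun θ =>
  abs_localPart_le_of_split L M hmean hmf θ

/-- Conversely, the δμ value of a renormalised frame is within the tolerance (no integrability needed). -/
theorem abs_klAngularMean_localPart_le_of_renormalisedAtF {β U μ : ℝ} {K : TrigPolyC4v} {R : RenConsts} {n : ℕ}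
    (h : RenormalisedAtF L M β U μ K R n) :
    |klAngularMean (klLocalPart L M β U μ K n)| ≤ R.cr * |U| * klScale klE0 n ^ 2 / klE0 :=
  abs_klAngularMean_le' h

end TwoLegG

end Summit.HubbardSuperconductivity.HubbardSuperconductivity.Theorems.KLRegimeSplit

end
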